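import Summits.QuantumFields.BalabanUV.Gaps.EndDrawdownLinearThreshold

/-!
# Gaps / EndDrawdownLinearStaircaseFamily — THE BLOCK BASE AGAINST THE CUBE OF THE RATE RATIO: a trichotomy for the dyadic-rate staircases.  For a block
# base `L ≥ 2` let `bSt L j := −2^{−⌊log_L(j+1)⌋}` (rate `1` on block `0`, halved on each successive block, block `t` having `(L−1)·L^t` indices; `L = 16`
# is gen 9's `bStair 1`, `L = 8` is `EndDrawdownLinearThreshold.bOct`).  On the linear road `|β¹_{k+1}| ≤ C·g_k`:
# * `2 ≤ L ≤ 7` (`L < 2³`): POSSIBLE for EVERY `C > 0` (`endPossibleLin_bSt_of_le_seven`) — FLOOR–ENTRY: entry drawdown `≤ 3·(7∕2)^T` into the block start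
#   `L^T − 1` against the floor `C²·4^T` of the tail rate `2^{−T}`;
# * `L = 8` (`= 2³`): a THRESHOLD in `C` (`EndDrawdownLinearThreshold.exists_threshold_bOct`; `bSt 8 = bOct`);
# * `L ≥ 9` (`> 2³`): IMPOSSIBLE for EVERY `C > 0` (`not_endPossibleLin_bSt_of_nine_le`) — CEILING–CHAIN: half-depth `(L−1)L^s∕2^{s+1} ≥ 4·(9∕2)^s` of block `s`
#   against the ceiling gap `12C²·4^s`, from block `s₀(C)` on.
# So for these β⁰-shapes the linear road reads, at END grade, ONE number: the growth base of the block lengths against the cube of the rate ratio — below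
# the cube the entry drawdown is dominated by the floor for every C, above it the chained ceilings descend below every clamp for every C, at the cube
# the constant decides (`staircase_trichotomy`) (cell pub-balaban-gaps, seat g1-p3 GEN 10, rows CAP ∕ tail ∕ (D4) «split ∕ weakening»; this seat's own
# leaf; file 25 of «the one-loop interface of the END statement»)

HONEST FRAMING (cell rule, page 1 of everything): [folklore] window arithmetic for an explicit one-parameter toy family, fed to the kernel-checked
floor–entry and ceiling–chain tests; `EndPossibleLin` is a quantified READING of the cell's END-grade statement over Bałaban-free data, not a binder;
the (AF-1) linear road is a located UNPRINTED hypothesis shape ([I] (2.12)–(2.14)); NOTHING of Bałaban's table is certified (NODE-O 0∕1, CAP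
coefficients 0); words ∕ odds of rows CAP ∕ tail ∕ (D4) ∕ (D1) UNCHANGED; 0∕6 binders; one finite T⁴; NOT [I] Thm 2, NOT `BetaPertH`, NOT the
continuum limit, NOT Clay.

CITATION HEADER (tags CONTEXT ONLY).  [I] = T. Bałaban, Commun. Math. Phys. **109** (1987) 249–301 [Balaban1987RG1]: (0.20) p. 256, Thm 2
p. 259 (first sentence), (2.12)–(2.14) p. 268.
-/

namespace Summit.QuantumFields.BalabanUV.Gaps.EndDrawdownLinearStaircaseFamily

open Literature.MathematicalPhysics.QuantumFieldTheory.Balaban1983to89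
open Literature.MathematicalPhysics.QuantumFieldTheory.Balaban1983to89.FlowStep
open Literature.MathematicalPhysics.QuantumFieldTheory.Balaban1983to89.FlowStepRuns
open Literature.MathematicalPhysics.QuantumFieldTheory.Balaban1983to89.DagBinding
open Summit.QuantumFields.BalabanUV.Gaps.EndDrawdownLinearRoad
open Summit.QuantumFields.BalabanUV.Gaps.EndDrawdownCooperatorExtremal
open Summit.QuantumFields.BalabanUV.Gaps.EndDrawdownLinearFloorEntry
open Summit.QuantumFields.BalabanUV.Gaps.EndDrawdownLinearCeiling
open Summit.QuantumFields.BalabanUV.Gaps.EndDrawdownLinearThreshold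
open Finset

noncomputable section

/-! ## §1 The family -/

section Family

variable {L : ℕ}

/-- The base-`L` position block of index `j`: `⌊log_L (j+1)⌋`. [folklore] -/
def blkL (L j : ℕ) : ℕ := Nat.log L (j + 1)

/-- The first index of base-`L` block `t`: `L^t − 1`. [folklore] -/
def bsL (L t : ℕ) : ℕ := L ^ t - 1

/-- THE DYADIC-RATE STAIRCASE WITH BLOCK BASE `L` · `bSt L j := −2^{−blkL L j}`. A TOY. [folklore] -/
def bSt (L j : ℕ) : ℝ := -(1 / 2 ^ blkL L j)

/-- `bSt 8` is the octal staircase of `EndDrawdownLinearThreshold`. [folklore] -/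
theorem bSt_eight : bSt 8 = bOct := by funext j; rfl

/-- Block membership (`1 < L`). [folklore] -/
theorem blkL_of_mem (hL : 1 < L) {j t : ℕ} (h1 : L ^ t ≤ j + 1) (h2 : j + 1 < L ^ (t + 1)) : blkL L j = t :=
  (Nat.log_eq_iff (Or.inr ⟨hL, Nat.succ_ne_zero j⟩)).mpr ⟨h1, h2⟩

/-- `bsL L t + 1 = L^t` (`1 < L`). [folklore] -/
theorem bsL_add_one (hL : 1 < L) (t : ℕ) : bsL L t + 1 = L ^ t := Nat.sub_add_cancel (Nat.one_le_pow _ _ (by omega))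

/-- `bsL L t ≤ j ⟺ t ≤ blkL L j` (`1 < L`). [folklore] -/
theorem bsL_le_iff (hL : 1 < L) {t j : ℕ} : bsL L t ≤ j ↔ t ≤ blkL L j := by
  have h1 : bsL L t ≤ j ↔ L ^ t ≤ j + 1 := by have := bsL_add_one hL t; constructor <;> intro h <;> omega
  rw [h1]
  exact (Nat.le_log_iff_pow_le hL (Nat.succ_ne_zero j)).symm

/-- Block starts increase strictly (`1 < L`): `bsL L s + 1 ≤ bsL L (s+1)`. [folklore] -/
theorem bsL_lt_succ (hL : 1 < L) (s : ℕ) : bsL L s + 1 ≤ bsL L (s + 1) := by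
  have hs := bsL_add_one hL s; have hs' := bsL_add_one hL (s + 1)
  have hp : L ^ s * 2 ≤ L ^ (s + 1) := by rw [pow_succ]; exact Nat.mul_le_mul_left _ hL
  have h1 : 1 ≤ L ^ s := Nat.one_le_pow _ _ (by omega)
  omega

/-- The length of block `s` as a real number: `(L − 1)·L^s`. [folklore] -/
theorem cast_blockLen (hL : 1 < L) (s : ℕ) : ((bsL L (s + 1) - bsL L s : ℕ) : ℝ) = ((L : ℝ) - 1) * (L : ℝ) ^ s := by
  have hs := bsL_add_one hL s; have hs' := bsL_add_one hL (s + 1)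
  have hle : bsL L s ≤ bsL L (s + 1) := by have := bsL_lt_succ hL s; omega
  have h1 : ((bsL L (s + 1) - bsL L s : ℕ) : ℝ) = (bsL L (s + 1) : ℝ) - (bsL L s : ℝ) := by rw [Nat.cast_sub hle]
  have h2 : ((bsL L s : ℕ) : ℝ) + 1 = (L : ℝ) ^ s := by exact_mod_cast hs
  have h3 : ((bsL L (s + 1) : ℕ) : ℝ) + 1 = (L : ℝ) ^ (s + 1) := by exact_mod_cast hs'
  rw [h1, pow_succ] at *
  linarith

/-- Every term is negative. [folklore] -/
theorem bSt_nonpos (j : ℕ) : bSt L j ≤ 0 := by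
  unfold bSt
  have : (0 : ℝ) < 1 / 2 ^ blkL L j := by positivity
  linarith

/-- Beyond the block start `L^T − 1` the rate is at most `2^{−T}` (`1 < L`). [folklore] -/
theorem bSt_ge_of_le (hL : 1 < L) {T j : ℕ} (hj : bsL L T ≤ j) : -(1 / 2 ^ T) ≤ bSt L j := by
  have hT : T ≤ blkL L j := (bsL_le_iff hL).mp hj
  unfold bSt
  have : (1 : ℝ) / 2 ^ blkL L j ≤ 1 / 2 ^ T := one_div_le_one_div_of_le (by positivity) (pow_le_pow_right₀ (by norm_num) hT)
  linarith

/-- On block `s` the rate is exactly `2^{−s}` (`1 < L`). [folklore] -/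
theorem bSt_le_of_mem (hL : 1 < L) {s j : ℕ} (h1 : bsL L s ≤ j) (h2 : j < bsL L (s + 1)) : bSt L j ≤ -(1 / 2 ^ s) := by
  have hs := bsL_add_one hL s; have hs' := bsL_add_one hL (s + 1)
  have hblk : blkL L j = s := blkL_of_mem hL (by omega) (by omega)
  unfold bSt; rw [hblk]

end Family

/-! ## §2 Base `L ≤ 7`: possible for every `C` (floor–entry) -/

section Small

variable {L : ℕ}

/-- For `2 ≤ L ≤ 7` the prefix drawdown before the block start `L^T − 1` is at most `3·(7∕2)^T` (block `s` weighs `(L−1)(L∕2)^s ≤ 6·(7∕2)^s`). [folklore] -/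
theorem sum_bSt_prefix_ge (hL : 1 < L) (hL7 : L ≤ 7) (T : ℕ) : -(3 * (7 / 2 : ℝ) ^ T) ≤ ∑ j ∈ range (bsL L T), bSt L j := by
  induction T with
  | zero => norm_num [bsL]
  | succ T ih =>
    have hle : bsL L T ≤ bsL L (T + 1) := by have := bsL_lt_succ hL T; omega
    rw [← Finset.sum_range_add_sum_Ico _ hle]
    have hL' : (L : ℝ) ≤ 7 := by exact_mod_cast hL7
    have hL1 : (1 : ℝ) < L := by exact_mod_cast hL
    have hblock : -(6 * (7 / 2 : ℝ) ^ T) ≤ ∑ j ∈ Ico (bsL L T) (bsL L (T + 1)), bSt L j := by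
      have h1 : ∑ j ∈ Ico (bsL L T) (bsL L (T + 1)), (-(1 / 2 ^ T : ℝ)) ≤ ∑ j ∈ Ico (bsL L T) (bsL L (T + 1)), bSt L j :=
        Finset.sum_le_sum fun j hj => bSt_ge_of_le hL (Finset.mem_Ico.mp hj).1
      rw [Finset.sum_const, Nat.card_Ico, nsmul_eq_mul, cast_blockLen hL T] at h1
      have e : ((L : ℝ) - 1) * (L : ℝ) ^ T * (1 / 2 ^ T) = ((L : ℝ) - 1) * ((L : ℝ) / 2) ^ T := by rw [div_pow]; field_simp
      have h2 : ((L : ℝ) / 2) ^ T ≤ (7 / 2) ^ T := pow_le_pow_left₀ (by positivity) (by linarith) T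
      have h3 : ((L : ℝ) - 1) * ((L : ℝ) / 2) ^ T ≤ 6 * (7 / 2) ^ T := by
        have : (0 : ℝ) ≤ ((L : ℝ) / 2) ^ T := by positivity
        nlinarith
      linarith
    have e7 : (7 / 2 : ℝ) ^ (T + 1) = 7 / 2 * (7 / 2) ^ T := by rw [pow_succ, mul_comm]
    have hpos : (0 : ℝ) ≤ (7 / 2) ^ T := by positivity
    rw [e7]; linarith

/-- Every window inside `[0, L^T − 1]` is at least `−3·(7∕2)^T` (`2 ≤ L ≤ 7`; all terms `≤ 0`). [folklore] -/
theorem window_bSt_ge (hL : 1 < L) (hL7 : L ≤ 7) {T i K' : ℕ} (hK : K' ≤ bsL L T) : -(3 * (7 / 2 : ℝ) ^ T) ≤ ∑ j ∈ Ico i K', bSt L j := by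
  have hsub : Ico i K' ⊆ range (bsL L T) := fun j hj => by simp only [mem_Ico] at hj; simp only [mem_range]; omega
  have h := Finset.sum_le_sum_of_subset_of_nonneg (f := fun j => -bSt L j) hsub fun j _ _ => by linarith [bSt_nonpos (L := L) j]
  simp only [Finset.sum_neg_distrib] at h
  linarith [sum_bSt_prefix_ge hL hL7 T]

/-- **BASE `L ≤ 7`: THE FLOOR–ENTRY CONDITION HOLDS FOR EVERY `C > 0`**: at level `A` choose `T` with `(7∕8)^T ≤ C²∕6` and `C²·4^T ≥ 2A`; checkpoint `L^T − 1`,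
tail rate `2^{−T}` (floor `C²·4^T`), entry ∕ internal drawdown `3·(7∕2)^T ≤ (C²∕2)·4^T`. [folklore] -/
theorem floorEntry_bSt_small (hL : 1 < L) (hL7 : L ≤ 7) {C : ℝ} (hC : 0 < C) (A : ℝ) :
    ∃ (I : ℕ) (ρ Dint Dent : ℝ), 0 < ρ ∧ (∀ j, I ≤ j → -ρ ≤ bSt L j) ∧
      (∀ i K', i ≤ K' → K' ≤ I → -Dint ≤ ∑ j ∈ Ico i K', bSt L j) ∧ (∀ i, i ≤ I → -Dent ≤ ∑ j ∈ Ico i I, bSt L j) ∧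
        A + Dent ≤ (C / ρ) ^ 2 := by
  obtain ⟨T₁, hT₁⟩ := exists_pow_lt_of_lt_one (show 0 < C ^ 2 / 6 by positivity) (show (7 / 8 : ℝ) < 1 by norm_num)
  obtain ⟨T₂, hT₂⟩ := pow_unbounded_of_one_lt (2 * A / C ^ 2) (by norm_num : (1 : ℝ) < 4)
  set T := max T₁ T₂ with hT
  have h78 : (7 / 8 : ℝ) ^ T ≤ C ^ 2 / 6 :=
    (pow_le_pow_of_le_one (by norm_num) (by norm_num) (le_max_left _ _)).trans hT₁.le
  have h4 : 2 * A / C ^ 2 < 4 ^ T := hT₂.trans_le (pow_le_pow_right₀ (by norm_num) (le_max_right _ _))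
  refine ⟨bsL L T, 1 / 2 ^ T, 3 * (7 / 2) ^ T, 3 * (7 / 2) ^ T, by positivity, fun j hj => bSt_ge_of_le hL hj,
    fun _ _ _ hKI => window_bSt_ge hL hL7 hKI, fun _ _ => window_bSt_ge hL hL7 le_rfl, ?_⟩
  have e : (C / (1 / 2 ^ T)) ^ 2 = C ^ 2 * 4 ^ T := by
    rw [show (4 : ℝ) ^ T = (2 ^ T) ^ 2 by rw [← pow_mul, mul_comm, pow_mul]; norm_num]; field_simp
  rw [e]
  have e72 : (7 / 2 : ℝ) ^ T = (7 / 8) ^ T * 4 ^ T := by rw [← mul_pow]; norm_num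
  have h4pos : (0 : ℝ) < 4 ^ T := by positivity
  have hA' : 2 * A < C ^ 2 * 4 ^ T := by rw [div_lt_iff₀ (by positivity)] at h4; linarith
  rw [e72]
  nlinarith [mul_le_mul_of_nonneg_right h78 h4pos.le]

/-- **BASE `2 ≤ L ≤ 7`: POSSIBLE ON THE LINEAR ROAD FOR EVERY `C > 0`** (every box). [cite: Balaban1987RG1, Thm 2 p.259 (first sentence) and (2.12)–(2.14) p.268] -/
theorem endPossibleLin_bSt_of_le_seven (hL : 1 < L) (hL7 : L ≤ 7) {C : ℝ} (hC : 0 < C) {γ₀ : ℝ} (hγ₀ : 0 < γ₀) :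
    EndPossibleLin (bSt L) C γ₀ :=
  endPossibleLin_of_floorEntry hC hγ₀ fun A _ => floorEntry_bSt_small hL hL7 hC A

end Small

/-! ## §3 Base `L ≥ 9`: impossible for every `C` (ceiling–chain) -/

section Large

variable {L : ℕ}

/-- The first good block for base `L ≥ 9`: `3C²·8^{s₀} ≤ 9^{s₀}`. [folklore] -/
theorem exists_goodBlock (C : ℝ) : ∃ s₀ : ℕ, 3 * C ^ 2 * 8 ^ s₀ ≤ (9 : ℝ) ^ s₀ := by
  obtain ⟨n, hn⟩ := pow_unbounded_of_one_lt (3 * C ^ 2) (by norm_num : (1 : ℝ) < 9 / 8)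
  refine ⟨n, ?_⟩
  have e : (9 : ℝ) ^ n = (9 / 8) ^ n * 8 ^ n := by rw [← mul_pow]; norm_num
  rw [e]; nlinarith [pow_pos (by norm_num : (0 : ℝ) < 8) n]

/-- **BASE `L ≥ 9`: DESCENDING STAIRCASES FOR EVERY `C > 0`**: from a good block `s₀` (`3C²·8^{s₀} ≤ 9^{s₀}`) on, the half-depth
`(L−1)L^t∕2^{t+1} ≥ 4·(9∕2)^t` of block `t = s₀ + s` covers the ceiling gap `12C²·4^t`; top rate `2^{−s₀}`, last half-depth `≥ D`. [folklore] -/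
theorem staircase_bSt_large (hL9 : 9 ≤ L) {C : ℝ} {s₀ : ℕ} (hs₀ : 3 * C ^ 2 * 8 ^ s₀ ≤ (9 : ℝ) ^ s₀) (D : ℝ) :
    ∃ (T : ℕ) (idx : ℕ → ℕ) (ε : ℕ → ℝ), 1 ≤ T ∧ (∀ s, s < T → idx s ≤ idx (s + 1)) ∧ (∀ s, s < T → 0 < ε s) ∧
      (1 : ℝ) / 2 ^ s₀ ≤ ε 0 ∧ (∀ s, s < T → ∀ j, idx s ≤ j → j < idx (s + 1) → bSt L j ≤ -ε s) ∧
      (∀ s, s + 1 < T → 4 * (C / ε (s + 1)) ^ 2 - 4 * (C / ε s) ^ 2 ≤ ((idx (s + 1) - idx s : ℕ) : ℝ) * (ε s / 2)) ∧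
      D ≤ ((idx T - idx (T - 1) : ℕ) : ℝ) * (ε (T - 1) / 2) := by
  have hL : 1 < L := by omega
  have hLr : (9 : ℝ) ≤ L := by exact_mod_cast hL9
  obtain ⟨T₀, hT₀⟩ := pow_unbounded_of_one_lt D (by norm_num : (1 : ℝ) < 9 / 2)
  -- half-depth of block t: ((L-1) L^t) * (1/2^t/2) ≥ 4 (9/2)^t
  have hhalf : ∀ t : ℕ, 4 * (9 / 2 : ℝ) ^ t ≤ ((bsL L (t + 1) - bsL L t : ℕ) : ℝ) * (1 / 2 ^ t / 2) := fun t => by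
    rw [cast_blockLen hL t]
    have h9 : (9 : ℝ) ^ t ≤ (L : ℝ) ^ t := pow_le_pow_left₀ (by norm_num) hLr t
    have h2 : (0 : ℝ) < 2 ^ t := by positivity
    have e : ((L : ℝ) - 1) * (L : ℝ) ^ t * (1 / 2 ^ t / 2) = (((L : ℝ) - 1) * (L : ℝ) ^ t / 2) * (1 / 2 ^ t) := by ring
    have e' : 4 * (9 / 2 : ℝ) ^ t = (4 * 9 ^ t) * (1 / 2 ^ t) := by rw [div_pow]; ring
    rw [e, e']
    apply mul_le_mul_of_nonneg_right _ (by positivity)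
    nlinarith [pow_nonneg (by norm_num : (0 : ℝ) ≤ 9) t]
  refine ⟨T₀ + 1, fun s => bsL L (s₀ + s), fun s => 1 / 2 ^ (s₀ + s), by omega, fun s _ => ?_, fun s _ => by positivity, by simp,
    fun s _ j hj1 hj2 => ?_, fun s _ => ?_, ?_⟩
  · dsimp only
    have := bsL_lt_succ hL (s₀ + s); rw [show s₀ + (s + 1) = s₀ + s + 1 by ring]; omega
  · dsimp only at hj1 hj2 ⊢
    rw [show s₀ + (s + 1) = s₀ + s + 1 by ring] at hj2
    exact bSt_le_of_mem hL hj1 hj2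
  · dsimp only
    set t : ℕ := s₀ + s with ht
    rw [show s₀ + (s + 1) = t + 1 by rw [ht]; ring]
    have hd := hhalf t
    have e1 : 4 * (C / (1 / 2 ^ (t + 1))) ^ 2 - 4 * (C / (1 / 2 ^ t)) ^ 2 = 12 * C ^ 2 * 4 ^ t := by
      rw [pow_succ, show (4 : ℝ) ^ t = (2 ^ t) ^ 2 by rw [← pow_mul, mul_comm, pow_mul]; norm_num]; field_simp; ring
    rw [e1]
    -- 12 C² 4^t ≤ 4 (9/2)^t ⟸ 3 C² 8^t ≤ 9^t ⟸ 3C² 8^{s₀} ≤ 9^{s₀} and 8^s ≤ 9^s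
    have h89 : (8 : ℝ) ^ s ≤ 9 ^ s := pow_le_pow_left₀ (by norm_num) (by norm_num) s
    have h8t : (8 : ℝ) ^ t = 8 ^ s₀ * 8 ^ s := by rw [ht, pow_add]
    have h9t : (9 : ℝ) ^ t = 9 ^ s₀ * 9 ^ s := by rw [ht, pow_add]
    have key : 3 * C ^ 2 * 8 ^ t ≤ 9 ^ t := by
      rw [h8t, h9t]
      have h1 := mul_le_mul hs₀ h89 (by positivity) (by positivity)
      nlinarith [pow_pos (by norm_num : (0:ℝ) < 8) s]
    have e2 : (9 : ℝ) ^ t = (9 / 2) ^ t * 2 ^ t := by rw [← mul_pow]; norm_num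
    have e3 : (8 : ℝ) ^ t = 4 ^ t * 2 ^ t := by rw [← mul_pow]; norm_num
    have h2t : (0 : ℝ) < 2 ^ t := by positivity
    rw [e2, e3] at key
    nlinarith
  · dsimp only
    rw [show T₀ + 1 - 1 = T₀ by omega, show s₀ + (T₀ + 1) = s₀ + T₀ + 1 by ring]
    have hd := hhalf (s₀ + T₀)
    have h1 : (9 / 2 : ℝ) ^ T₀ ≤ (9 / 2) ^ (s₀ + T₀) := pow_le_pow_right₀ (by norm_num) (by omega)
    have h0 : (0 : ℝ) ≤ (9 / 2) ^ (s₀ + T₀) := by positivity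
    linarith

/-- **BASE `L ≥ 9`: IMPOSSIBLE ON THE LINEAR ROAD FOR EVERY `C > 0`** (every box). [cite: Balaban1987RG1, Thm 2 p.259 (first sentence) and (2.12)–(2.14) p.268] -/
theorem not_endPossibleLin_bSt_of_nine_le (hL9 : 9 ≤ L) {C : ℝ} (hC : 0 < C) {γ₀ : ℝ} (hγ₀ : 0 < γ₀) : ¬ EndPossibleLin (bSt L) C γ₀ := by
  obtain ⟨s₀, hs₀⟩ := exists_goodBlock C
  exact not_endPossibleLin_of_staircase hC (show (0 : ℝ) < 1 / 2 ^ s₀ by positivity) (fun D => staircase_bSt_large hL9 hs₀ D) hγ₀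

end Large

/-! ## §4 The trichotomy -/

/-- **THE BLOCK BASE AGAINST THE CUBE OF THE RATE RATIO** · for the dyadic-rate staircases `bSt L` (`L ≥ 2`) on the linear road:
`L ≤ 7` ⟹ possible for EVERY `C > 0`; `L = 8` ⟹ a threshold `C⋆ ∈ [1∕2, 2]` (possible above, impossible below); `L ≥ 9` ⟹ impossible for EVERY
`C > 0` — on every box. [cite: Balaban1987RG1, Thm 2 p.259 (first sentence) and (2.12)–(2.14) p.268] -/
theorem staircase_trichotomy {L : ℕ} (hL : 2 ≤ L) {γ₀ : ℝ} (hγ₀ : 0 < γ₀) :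
    (L ≤ 7 → ∀ C : ℝ, 0 < C → EndPossibleLin (bSt L) C γ₀) ∧
      (L = 8 → ∃ Cstar : ℝ, 1 / 2 ≤ Cstar ∧ Cstar ≤ 2 ∧ (∀ C, Cstar < C → EndPossibleLin (bSt L) C γ₀) ∧
        ∀ C, 0 < C → C < Cstar → ¬ EndPossibleLin (bSt L) C γ₀) ∧
      (9 ≤ L → ∀ C : ℝ, 0 < C → ¬ EndPossibleLin (bSt L) C γ₀) :=
  ⟨fun h7 _ hC => endPossibleLin_bSt_of_le_seven (by omega) h7 hC hγ₀,
    fun h8 => by subst h8; rw [bSt_eight]; exact exists_threshold_bOct hγ₀,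
    fun h9 _ hC => not_endPossibleLin_bSt_of_nine_le h9 hC hγ₀⟩

end

end Summit.QuantumFields.BalabanUV.Gaps.EndDrawdownLinearStaircaseFamily
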